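import Summits.FinalStateConjecture.FinalStateConjecture.Theorems.UniformPhotonSphereChannels.Negative.NearConeEnergy
import Summits.FinalStateConjecture.FinalStateConjecture.Theorems.UniformPhotonSphereChannels.Negative.PolyTime
import Summits.FinalStateConjecture.FinalStateConjecture.Theorems.UniformPhotonSphereChannels.Negative.KernelDecayMain

/-!
# Crux `UniformPhotonSphereChannels` (K1), negative side — the kernel census, inductive step

Support file of the standing disprover of item stmt-FinalStateConjecture-10045.  Setting: `V ∈ C¹`,
`V ≥ 0`, `V ≤ C e^{κx}` on `(−∞, e₀)`; `p` is `C²` on the near cone `Ω = {x + |t| < e₀}`, solves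
`p_tt − p_xx + V p = 0` there, is a polynomial in `t` there, `p = Σ_{i ≤ n} aᵢ(x) tⁱ` with `n ≥ 1`,
and has finite energy at `t = 0` on `(−∞, e₀)`.  Conclusion (`top_coeff_eq_zero`): the top
coefficient `aₙ` vanishes on `(−∞, e₀)`.

Proof: finite differences in `t` of `p_t` express `aₙ` through `p_t(kτ, ·)`, `k < n`, whose
`L²(−∞, X)` norms are bounded by the (monotone) near-cone energy, so `aₙ ∈ L²(−∞, X)`; finite
differences of `p` itself show `aₙ ∈ C²` with `aₙ'' = V aₙ` (the `t`-derivatives drop out); the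
decay lemma `KernelDecay.eq_zero_of_sq_integrableOn` gives `aₙ = 0`. [folklore]
-/

namespace Summit.FinalStateConjecture.FinalStateConjecture.Theorems

open MeasureTheory Set Filter Topology Finset

noncomputable section

namespace KernelCensus

open WaveEnergy

variable {V : ℝ → ℝ} {e₀ : ℝ} {p : ℝ → ℝ → ℝ}

/-- Slice regularity of a function `C²` on the near cone, read through a global `C²` extension:
for `ε > 0` there is a global `C²` `u` such that on `{x + |t| < e₀ − ε/2}` the curried first
derivatives and values of `p` are those of `u`, and the `x`-slices of `p` are twice differentiable
with `deriv`/`iteratedDeriv 2` as derivatives. -/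
theorem exists_extension_slices (hp : ContDiffOn ℝ 2 (Function.uncurry p) {z : ℝ × ℝ | z.2 + |z.1| < e₀})
    {ε : ℝ} (hε : 0 < ε) :
    ∃ u : ℝ × ℝ → ℝ, ContDiff ℝ 2 u ∧ ∀ t x : ℝ, x + |t| < e₀ - ε / 2 →
      deriv (fun τ => p τ x) t = fderiv ℝ u (t, x) (1, 0) ∧ p t x = u (t, x) ∧
      HasDerivAt (p t) (deriv (p t) x) x ∧
      HasDerivAt (fun y => deriv (p t) y) (iteratedDeriv 2 (p t) x) x := by
  obtain ⟨u, hu, huN⟩ := exists_cutoff_extension hp hε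
  have hN : IsOpen {w : ℝ × ℝ | w.2 + |w.1| < e₀ - ε / 2} := isOpen_lt (by fun_prop) continuous_const
  set uc : ℝ → ℝ → ℝ := fun τ y => u (τ, y) with huc
  have hucu : Function.uncurry uc = u := by funext z; rfl
  have huc2 : ContDiff ℝ 2 (Function.uncurry uc) := by rw [hucu]; exact hu
  refine ⟨u, hu, fun t x hx => ?_⟩
  obtain ⟨h1, h2⟩ := slices_eventuallyEq (p := p) hN huN (t := t) (x := x) hx
  have e1 := deriv_slice_fst_eq huc2 t x
  have e4 := iteratedDeriv_two_slice_snd_eq huc2 t x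
  rw [hucu] at e1 e4
  simp only [huc] at e1 e4
  have hp0 : p t x = u (t, x) := by
    have := (huN (t, x) hx).self_of_nhds
    simpa using this.symm
  have hpt : (fun y' => p t y') = p t := rfl
  refine ⟨by rw [← h1.deriv_eq, e1], hp0, ?_, ?_⟩
  · have hd : HasDerivAt (fun y => u (t, y)) (fderiv ℝ u (t, x) (0, 1)) x :=
      hasDerivAt_slice_snd (differentiable_of_contDiff_two hu) t x
    have hd' : HasDerivAt (p t) (fderiv ℝ u (t, x) (0, 1)) x := by
      rw [← hpt]; exact hd.congr_of_eventuallyEq h2.symm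
    rwa [hd'.deriv]
  · -- `deriv (p t)` agrees near `x` with `y ↦ ∂u(t,y)(0,1)`
    have h3 : (fun y => deriv (p t) y) =ᶠ[𝓝 x] fun y => fderiv ℝ u (t, y) (0, 1) := by
      have hev : ∀ᶠ y in 𝓝 x, (t, y) ∈ {w : ℝ × ℝ | w.2 + |w.1| < e₀ - ε / 2} :=
        (Continuous.prodMk_right t).continuousAt.preimage_mem_nhds (hN.mem_nhds hx)
      filter_upwards [hev] with y hy
      obtain ⟨-, h2y⟩ := slices_eventuallyEq (p := p) hN huN (t := t) (x := y) hy
      have hdy : HasDerivAt (fun y => u (t, y)) (fderiv ℝ u (t, y) (0, 1)) y :=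
        hasDerivAt_slice_snd (differentiable_of_contDiff_two hu) t y
      have : HasDerivAt (p t) (fderiv ℝ u (t, y) (0, 1)) y := by
        rw [← hpt]; exact hdy.congr_of_eventuallyEq h2y.symm
      exact this.deriv
    have hd2 : HasDerivAt (fun y => fderiv ℝ u (t, y) (0, 1))
        (fderiv ℝ (fderiv ℝ u) (t, x) (0, 1) (0, 1)) x := hasDerivAt_fderiv_apply_slice_snd hu (0, 1) t x
    have hd3 := hd2.congr_of_eventuallyEq h3
    rw [← e4, h2.iteratedDeriv_eq 2, hpt] at hd3
    exact hd3

/-- **Census, inductive step: the top `t`-coefficient vanishes.**  See the module docstring. -/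
theorem top_coeff_eq_zero (hV : ContDiff ℝ 1 V) (hV0 : ∀ x, 0 ≤ V x) {C κ : ℝ} (hκ : 0 < κ)
    (hC : 0 ≤ C) (hVexp : ∀ x < e₀, V x ≤ C * Real.exp (κ * x))
    (hp : ContDiffOn ℝ 2 (Function.uncurry p) {z : ℝ × ℝ | z.2 + |z.1| < e₀})
    (hsol : ∀ z : ℝ × ℝ, z.2 + |z.1| < e₀ →
      iteratedDeriv 2 (fun τ => p τ z.2) z.1 - iteratedDeriv 2 (p z.1) z.2 + V z.2 * p z.1 z.2 = 0)
    {n : ℕ} (hn : 1 ≤ n) {a : ℕ → ℝ → ℝ}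
    (ha : ∀ z : ℝ × ℝ, z.2 + |z.1| < e₀ → p z.1 z.2 = ∑ i ∈ range (n + 1), a i z.2 * z.1 ^ i)
    (hzero : ∀ i, n + 1 ≤ i → ∀ x < e₀, a i x = 0)
    (hfin : ∫⁻ x in Iio e₀, ENNReal.ofReal
      (deriv (fun τ => p τ x) 0 ^ 2 + deriv (p 0) x ^ 2 + V x * p 0 x ^ 2) < ⊤) :
    ∀ x < e₀, a n x = 0 := by
  intro x₀ hx₀
  -- geometry: `X = e₀ − 3δ`, nodes `k τ₁ ∈ [0, δ]`
  set X : ℝ := (x₀ + e₀) / 2 with hX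
  set δ : ℝ := (e₀ - X) / 3 with hδ
  have hδpos : 0 < δ := by rw [hδ, hX]; linarith
  have hXe : X = e₀ - 3 * δ := by rw [hδ]; ring
  have hx₀X : x₀ < X := by rw [hX]; linarith
  obtain ⟨m, rfl⟩ : ∃ m, n = m + 1 := ⟨n - 1, by omega⟩
  set τ₁ : ℝ := δ / ((m + 1 : ℕ) : ℝ) with hτ₁
  have hn0 : (0 : ℝ) < ((m + 1 : ℕ) : ℝ) := by positivity
  have hτ₁pos : 0 < τ₁ := div_pos hδpos hn0
  have hnode : ∀ k ∈ range (m + 1 + 1), 0 ≤ (k : ℝ) * τ₁ ∧ (k : ℝ) * τ₁ ≤ δ := by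
    intro k hk
    refine ⟨by positivity, ?_⟩
    have hk' : (k : ℝ) ≤ ((m + 1 : ℕ) : ℝ) := by exact_mod_cast Nat.lt_succ_iff.mp (mem_range.mp hk)
    calc (k : ℝ) * τ₁ ≤ ((m + 1 : ℕ) : ℝ) * τ₁ := mul_le_mul_of_nonneg_right hk' hτ₁pos.le
      _ = δ := by rw [hτ₁]; field_simp
  -- the extension and slice facts on `N = {x + |t| < e₀ − δ/2}`
  obtain ⟨u, hu, hsl⟩ := exists_extension_slices hp hδpos
  have hmemN : ∀ x < X, ∀ t : ℝ, 0 ≤ t → t ≤ δ → x + |t| < e₀ - δ / 2 := by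
    intro x hx t ht0 htδ
    rw [abs_of_nonneg ht0]; linarith
  -- coefficient sequences at a point
  have hcvan : ∀ x < e₀, ∀ i, m + 1 + 1 ≤ i → a i x = 0 := fun x hx i hi => hzero i hi x hx
  -- slices are the polynomial near every `t` with `x + |t| < e₀`
  have hslice_poly : ∀ x t : ℝ, x + |t| < e₀ →
      (fun τ => p τ x) =ᶠ[𝓝 t] fun τ => ∑ i ∈ range (m + 1 + 1), a i x * τ ^ i := by
    intro x t hxt
    have hO : IsOpen {τ : ℝ | x + |τ| < e₀} := isOpen_lt (by fun_prop) continuous_const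
    filter_upwards [hO.mem_nhds hxt] with τ hτ
    exact ha (τ, x) hτ
  -- (1) `p_t(t, x)` as a polynomial sum of `m + 1` terms with top coefficient `(m+1) a_{m+1}(x)`
  have hpt : ∀ x < e₀, ∀ t : ℝ, x + |t| < e₀ →
      deriv (fun τ => p τ x) t
        = ∑ i ∈ range (m + 1), (((i + 1 : ℕ) : ℝ) * a (i + 1) x) * t ^ i := by
    intro x hx t hxt
    rw [deriv_eq_of_eventuallyEq_polySum (fun i => a i x) (m + 1 + 1) (hcvan x hx) (hslice_poly x t hxt),
      sum_range_succ, hcvan x hx (m + 1 + 1) le_rfl]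
    simp
  -- (2) finite differences of `p_t`: `a_{m+1}(x) = K₀⁻¹ Σ_k z_k • p_t(k τ₁, x)` for `x < X`
  set K₀ : ℝ := (m.factorial : ℝ) * τ₁ ^ m * ((m + 1 : ℕ) : ℝ) with hK₀
  have hK₀ne : K₀ ≠ 0 := by rw [hK₀]; positivity
  have hextract : ∀ x < X, a (m + 1) x = K₀⁻¹ *
      ∑ k ∈ range (m + 1), ((-1 : ℤ) ^ (m - k) * (m.choose k : ℤ)) • deriv (fun τ => p τ x) ((k : ℝ) * τ₁) := by
    intro x hx
    have hxe : x < e₀ := by linarith [hXe, hδpos]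
    have key := sum_smul_polySum_eq (fun i => ((i + 1 : ℕ) : ℝ) * a (i + 1) x) m τ₁
    have hrw : ∀ k ∈ range (m + 1), deriv (fun τ => p τ x) ((k : ℝ) * τ₁)
        = ∑ i ∈ range (m + 1), (((i + 1 : ℕ) : ℝ) * a (i + 1) x) * ((k : ℝ) * τ₁) ^ i := by
      intro k hk
      have hk' : k ∈ range (m + 1 + 1) := mem_range.mpr (Nat.lt_succ_of_lt (mem_range.mp hk))
      obtain ⟨h0, hδ'⟩ := hnode k hk'
      have hxt : x + |(k : ℝ) * τ₁| < e₀ := lt_of_lt_of_le (hmemN x hx _ h0 hδ') (by linarith)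
      exact hpt x hxe _ hxt
    have hrw' : ∑ k ∈ range (m + 1), ((-1 : ℤ) ^ (m - k) * (m.choose k : ℤ)) •
          deriv (fun τ => p τ x) ((k : ℝ) * τ₁)
        = ∑ k ∈ range (m + 1), ((-1 : ℤ) ^ (m - k) * (m.choose k : ℤ)) •
          ∑ i ∈ range (m + 1), (((i + 1 : ℕ) : ℝ) * a (i + 1) x) * ((k : ℝ) * τ₁) ^ i :=
      sum_congr rfl fun k hk => by rw [hrw k hk]
    rw [hrw', key, hK₀]
    field_simp
  -- (3) energy bounds: `∫_{x<X} p_t(kτ₁,·)² ≤ E₁ < ∞`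
  set E₁ : ENNReal := ∫⁻ x in Iio (e₀ - δ), ENNReal.ofReal
      (deriv (fun τ => p τ x) 0 ^ 2 + deriv (p 0) x ^ 2 + V x * p 0 x ^ 2) with hE₁
  have hE₁fin : E₁ < ⊤ :=
    lt_of_le_of_lt (lintegral_mono_set (Iio_subset_Iio (by linarith))) hfin
  have hEk : ∀ k ∈ range (m + 1 + 1),
      ∫⁻ x in Iio X, ENNReal.ofReal (deriv (fun τ => p τ x) ((k : ℝ) * τ₁) ^ 2) ≤ E₁ := by
    intro k hk
    obtain ⟨h0, hδ'⟩ := hnode k hk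
    calc ∫⁻ x in Iio X, ENNReal.ofReal (deriv (fun τ => p τ x) ((k : ℝ) * τ₁) ^ 2)
        ≤ ∫⁻ x in Iio X, ENNReal.ofReal (deriv (fun τ => p τ x) ((k : ℝ) * τ₁) ^ 2
            + deriv (p ((k : ℝ) * τ₁)) x ^ 2 + V x * p ((k : ℝ) * τ₁) x ^ 2) := by
          refine lintegral_mono fun x => ENNReal.ofReal_le_ofReal ?_
          nlinarith [sq_nonneg (deriv (p ((k : ℝ) * τ₁)) x), mul_nonneg (hV0 x) (sq_nonneg (p ((k : ℝ) * τ₁) x))]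
      _ ≤ ∫⁻ x in Iio (e₀ - δ - (k : ℝ) * τ₁), ENNReal.ofReal (deriv (fun τ => p τ x) ((k : ℝ) * τ₁) ^ 2
            + deriv (p ((k : ℝ) * τ₁)) x ^ 2 + V x * p ((k : ℝ) * τ₁) x ^ 2) :=
          lintegral_mono_set (Iio_subset_Iio (by linarith))
      _ ≤ E₁ := nearCone_lintegral_shrinking_le hV hV0 hp hsol hδpos h0
  -- measurability of `x ↦ p_t(kτ₁, x)²` on `(-∞, X)` through the extension `u`
  have hmeas : ∀ k ∈ range (m + 1 + 1), AEMeasurable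
      (fun x => ENNReal.ofReal (deriv (fun τ => p τ x) ((k : ℝ) * τ₁) ^ 2)) (volume.restrict (Iio X)) := by
    intro k hk
    obtain ⟨h0, hδ'⟩ := hnode k hk
    have hcont : Continuous fun x => ENNReal.ofReal (fderiv ℝ u ((k : ℝ) * τ₁, x) (1, 0) ^ 2) := by
      have := (continuous_fderiv_apply hu (1, 0)).comp (Continuous.prodMk_right ((k : ℝ) * τ₁))
      exact ENNReal.continuous_ofReal.comp (this.pow 2)
    refine hcont.measurable.aemeasurable.congr ?_
    refine ae_restrict_of_forall_mem measurableSet_Iio fun x hx => ?_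
    beta_reduce
    rw [(hsl _ x (hmemN x hx _ h0 hδ')).1]
  -- pointwise Cauchy–Schwarz and the `L²` bound for the top coefficient
  set Kc : ℝ := (K₀⁻¹) ^ 2 * ∑ k ∈ range (m + 1),
      (((-1 : ℤ) ^ (m - k) * (m.choose k : ℤ) : ℤ) : ℝ) ^ 2 with hKc
  have hKc0 : 0 ≤ Kc := by rw [hKc]; positivity
  have hptw : ∀ x < X, a (m + 1) x ^ 2
      ≤ Kc * ∑ k ∈ range (m + 1), deriv (fun τ => p τ x) ((k : ℝ) * τ₁) ^ 2 := by
    intro x hx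
    rw [hextract x hx, mul_pow, hKc, mul_assoc]
    exact mul_le_mul_of_nonneg_left (sq_sum_smul_le m _) (sq_nonneg _)
  have hL2 : ∫⁻ x in Iio X, ENNReal.ofReal (a (m + 1) x ^ 2) < ⊤ := by
    have h1 : ∫⁻ x in Iio X, ENNReal.ofReal (a (m + 1) x ^ 2)
        ≤ ∫⁻ x in Iio X, ENNReal.ofReal (Kc * ∑ k ∈ range (m + 1),
            deriv (fun τ => p τ x) ((k : ℝ) * τ₁) ^ 2) := by
      refine setLIntegral_mono' measurableSet_Iio fun x hx => ENNReal.ofReal_le_ofReal (hptw x hx)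
    have h2 : ∫⁻ x in Iio X, ENNReal.ofReal (Kc * ∑ k ∈ range (m + 1),
            deriv (fun τ => p τ x) ((k : ℝ) * τ₁) ^ 2)
        = ENNReal.ofReal Kc * ∑ k ∈ range (m + 1),
            ∫⁻ x in Iio X, ENNReal.ofReal (deriv (fun τ => p τ x) ((k : ℝ) * τ₁) ^ 2) := by
      have hmeas' : ∀ k ∈ range (m + 1), AEMeasurable
          (fun x => ENNReal.ofReal (deriv (fun τ => p τ x) ((k : ℝ) * τ₁) ^ 2)) (volume.restrict (Iio X)) :=
        fun k hk => hmeas k (mem_range.mpr (Nat.lt_succ_of_lt (mem_range.mp hk)))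
      rw [← lintegral_finsetSum' _ hmeas', ← lintegral_const_mul' _ _ ENNReal.ofReal_ne_top]
      refine lintegral_congr fun x => ?_
      rw [ENNReal.ofReal_mul hKc0, ENNReal.ofReal_sum_of_nonneg (fun k _ => sq_nonneg _)]
    have h3 : ∑ k ∈ range (m + 1),
        ∫⁻ x in Iio X, ENNReal.ofReal (deriv (fun τ => p τ x) ((k : ℝ) * τ₁) ^ 2)
        ≤ ∑ k ∈ range (m + 1), E₁ :=
      sum_le_sum fun k hk => hEk k (mem_range.mpr (Nat.lt_succ_of_lt (mem_range.mp hk)))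
    have h4 : ENNReal.ofReal Kc * ∑ k ∈ range (m + 1),
        ∫⁻ x in Iio X, ENNReal.ofReal (deriv (fun τ => p τ x) ((k : ℝ) * τ₁) ^ 2)
        ≤ ENNReal.ofReal Kc * ∑ k ∈ range (m + 1), E₁ := by gcongr
    refine lt_of_le_of_lt (h1.trans (h2.le.trans h4)) ?_
    rw [sum_const, card_range, nsmul_eq_mul]
    exact ENNReal.mul_lt_top ENNReal.ofReal_lt_top (ENNReal.mul_lt_top (ENNReal.natCast_lt_top _) hE₁fin)
  -- (4) the explicit `C²` representative `A` of `a_{m+1}` on `(-∞, X)` and its ODE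
  set w : ℕ → ℝ := fun k => (((-1 : ℤ) ^ (m + 1 - k) * ((m + 1).choose k : ℤ) : ℤ) : ℝ) with hw
  set K₂ : ℝ := ((m + 1).factorial : ℝ) * τ₁ ^ (m + 1) with hK₂
  have hK₂ne : K₂ ≠ 0 := by rw [hK₂]; positivity
  set A : ℝ → ℝ := fun x => K₂⁻¹ * ∑ k ∈ range (m + 1 + 1), w k * p ((k : ℝ) * τ₁) x with hA
  set A' : ℝ → ℝ := fun x => K₂⁻¹ * ∑ k ∈ range (m + 1 + 1), w k * deriv (p ((k : ℝ) * τ₁)) x with hA'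
  have hAeq : ∀ x < X, A x = a (m + 1) x := by
    intro x hx
    have key := sum_smul_polySum_eq (fun i => a i x) (m + 1) τ₁
    have hrw : ∑ k ∈ range (m + 1 + 1), ((-1 : ℤ) ^ (m + 1 - k) * ((m + 1).choose k : ℤ)) •
          ∑ i ∈ range (m + 1 + 1), a i x * ((k : ℝ) * τ₁) ^ i
        = ∑ k ∈ range (m + 1 + 1), w k * p ((k : ℝ) * τ₁) x := by
      refine sum_congr rfl fun k hk => ?_
      obtain ⟨h0, hδ'⟩ := hnode k hk
      have hxt : x + |(k : ℝ) * τ₁| < e₀ := lt_of_lt_of_le (hmemN x hx _ h0 hδ') (by linarith)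
      rw [zsmul_eq_mul, hw, ha ((k : ℝ) * τ₁, x) hxt]
    rw [hrw] at key
    rw [hA]
    simp only
    rw [key, hK₂]
    field_simp
  have hAd : ∀ x < X, HasDerivAt A (A' x) x := by
    intro x hx
    have h : HasDerivAt (fun y => ∑ k ∈ range (m + 1 + 1), w k * p ((k : ℝ) * τ₁) y)
        (∑ k ∈ range (m + 1 + 1), w k * deriv (p ((k : ℝ) * τ₁)) x) x := by
      refine HasDerivAt.fun_sum fun k hk => ?_
      obtain ⟨h0, hδ'⟩ := hnode k hk
      exact ((hsl _ x (hmemN x hx _ h0 hδ')).2.2.1).const_mul (w k)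
    exact h.const_mul K₂⁻¹
  have hA'd : ∀ x < X, HasDerivAt A' (V x * A x) x := by
    intro x hx
    have hxe : x < e₀ := by linarith [hXe, hδpos]
    have h : HasDerivAt (fun y => ∑ k ∈ range (m + 1 + 1), w k * deriv (p ((k : ℝ) * τ₁)) y)
        (∑ k ∈ range (m + 1 + 1), w k * iteratedDeriv 2 (p ((k : ℝ) * τ₁)) x) x := by
      refine HasDerivAt.fun_sum fun k hk => ?_
      obtain ⟨h0, hδ'⟩ := hnode k hk
      exact ((hsl _ x (hmemN x hx _ h0 hδ')).2.2.2).const_mul (w k)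
    have h' := h.const_mul K₂⁻¹
    refine h'.congr_deriv ?_
    -- `Σ w_k p_xx(kτ₁, x) = Σ w_k (p_tt(kτ₁, x) + V p(kτ₁, x))`, and the `p_tt` part drops out
    have hxx : ∀ k ∈ range (m + 1 + 1), iteratedDeriv 2 (p ((k : ℝ) * τ₁)) x
        = iteratedDeriv 2 (fun τ => p τ x) ((k : ℝ) * τ₁) + V x * p ((k : ℝ) * τ₁) x := by
      intro k hk
      obtain ⟨h0, hδ'⟩ := hnode k hk
      have hxt : x + |(k : ℝ) * τ₁| < e₀ := lt_of_lt_of_le (hmemN x hx _ h0 hδ') (by linarith)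
      have := hsol ((k : ℝ) * τ₁, x) hxt
      simp only at this
      linarith
    have htt : ∀ k ∈ range (m + 1 + 1), iteratedDeriv 2 (fun τ => p τ x) ((k : ℝ) * τ₁)
        = ∑ i ∈ range (m + 1), (((i + 1 : ℕ) : ℝ) * ((((i + 1 + 1 : ℕ) : ℝ)) * a (i + 1 + 1) x))
            * ((k : ℝ) * τ₁) ^ i := by
      intro k hk
      obtain ⟨h0, hδ'⟩ := hnode k hk
      have hxt : x + |(k : ℝ) * τ₁| < e₀ := lt_of_lt_of_le (hmemN x hx _ h0 hδ') (by linarith)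
      rw [iteratedDeriv_two_eq_of_eventuallyEq_polySum (fun i => a i x) (m + 1 + 1) (hcvan x hxe)
        (hslice_poly x _ hxt), sum_range_succ, hcvan x hxe (m + 1 + 1 + 1) (by omega)]
      simp
    have hvanish : ∑ k ∈ range (m + 1 + 1), w k * iteratedDeriv 2 (fun τ => p τ x) ((k : ℝ) * τ₁) = 0 := by
      have key := sum_smul_polySum_eq_zero
        (fun i => ((i + 1 : ℕ) : ℝ) * ((((i + 1 + 1 : ℕ) : ℝ)) * a (i + 1 + 1) x)) (m + 1) τ₁
      rw [← key]
      refine sum_congr rfl fun k hk => ?_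
      rw [zsmul_eq_mul, hw, htt k hk]
    calc K₂⁻¹ * ∑ k ∈ range (m + 1 + 1), w k * iteratedDeriv 2 (p ((k : ℝ) * τ₁)) x
        = K₂⁻¹ * (∑ k ∈ range (m + 1 + 1), w k * iteratedDeriv 2 (fun τ => p τ x) ((k : ℝ) * τ₁)
            + V x * ∑ k ∈ range (m + 1 + 1), w k * p ((k : ℝ) * τ₁) x) := by
          congr 1
          rw [mul_sum, ← sum_add_distrib]
          exact sum_congr rfl fun k hk => by rw [hxx k hk]; ring
      _ = V x * A x := by rw [hvanish, zero_add, hA]; ring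
  -- (5) integrability of `A²` on `(-∞, X)` and the decay lemma
  have hAcont : ContinuousOn A (Iio X) := fun x hx => (hAd x hx).continuousAt.continuousWithinAt
  have hint : IntegrableOn (fun x => A x ^ 2) (Iio X) := by
    refine ⟨(hAcont.pow 2).aestronglyMeasurable measurableSet_Iio, ?_⟩
    rw [HasFiniteIntegral]
    have h1 : ∫⁻ x in Iio X, ‖A x ^ 2‖ₑ = ∫⁻ x in Iio X, ENNReal.ofReal (a (m + 1) x ^ 2) := by
      refine setLIntegral_congr_fun measurableSet_Iio fun x hx => ?_
      rw [Real.enorm_eq_ofReal (sq_nonneg _), hAeq x hx]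
    rw [h1]
    exact hL2
  have hzeroA := KernelDecay.eq_zero_of_sq_integrableOn (X := X) hκ hC hV.continuous hV0
    (fun x hx => hVexp x (by linarith [hXe, hδpos])) hAd hA'd hint
  rw [← hAeq x₀ hx₀X]
  exact hzeroA x₀ hx₀X

end KernelCensus

end

end Summit.FinalStateConjecture.FinalStateConjecture.Theorems
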